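import Summits.NavierStokesRegularity.FluidComputer.ClayBlowupTaoPressure
import Summits.NavierStokesRegularity.FluidComputer.DesignedBlowupSubLerayRate
import HarnessLib

/-!
# The Serrin scale on `ClayBlowup ν` WITH NO PRESSURE HYPOTHESIS: Sohr corner, Type-II floor, no
# sub-Leray rate — for every breakdown scenario of Fefferman's (C)

Cell `ns-blowup`, seat `ns-blowup-ecbridge-2` (g5; the E–C endpoint theory seat). LABEL: E–C typing
(KERNEL — no named fact). WHAT THIS IS NOT: not Navier–Stokes evidence — necessary conditions on the
TYPE `ClayBlowup` (no inhabitant is claimed anywhere), hence — by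
`navierStokesBreakdownR3_iff_exists_nonempty_clayBlowup` — on every breakdown scenario for (C).
Companion memo: `run/shared/lean/pub/ns-blowup/ecbridge2/ECBRIDGE-2-MEMO-4.md`.

## Content

For `X : ClayBlowup ν`, `ν > 0` (no hypothesis on the pressure, on `∂ₜu`, or on anything else):

* `ClayBlowup.enstrophy_le_of_serrin` — if `∫₀ᵀ ‖u‖_{L^r}^{2/(1−3/r)} < ∞` for some `3 < r ≤ ∞` then
  the enstrophy is bounded on `[0, T)` (LR16 (11.11) = the tree's PROVED forced Serrin–Grönwall
  inequality on each closed sub-slab `[0, s]`, fed the Tao-class pressure of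
  `ClayBlowup.exists_taoPressure` on that sub-slab; the right-hand side is monotone in `s`);
* **`ClayBlowup.lintegral_serrin_eq_top`** — THE SOHR CORNER: `∫₀ᵀ ‖u(t)‖_{L^r}^{2/(1−3/r)} dt = ∞`
  for every `3 < r ≤ ∞` (the `H¹` alternative `not_exists_enstrophy_bound` closes the argument);
* **`ClayBlowup.not_subLerayRate`** — no rate `‖u(t)‖_{L^r} ≤ C (T−t)^{−γ}` with
  `γ < (1 − 3/r)/2`; **`ClayBlowup.not_subTypeI`** — the case `r = ∞`: no `‖u(t)‖_∞ ≤ C(T−t)^{−γ}`,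
  `γ < 1/2` (Type I is the borderline);
* `DesignedBlowup.lintegral_serrin_eq_top_all`, `DesignedBlowup.not_subTypeI_all`,
  `DesignedBlowup.not_subLerayRate_all` — the same on the strong type, superseding the gauge-qualified
  rows of `DesignedBlowupUnconditional.lean`;
* `breakdownR3_serrin` — (C) ⇒ at every `ν > 0` a Clay evolution leaving EVERY Serrin class at its
  lifespan.

References: H. Sohr (2001), Thm. V.1.8.1 [cite: Sohr2001, Thm. V.1.8.1]; P. G. Lemarié-Rieusset
(2016), Thm. 7.2, Thm. 11.2 (11.11), Thm. 11.4 [cite: LemarieRieusset2016, Thm. 11.2]; J. Leray,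
Acta Math. 63 (1934), (3.16) [cite: Leray1934, (3.16)]; T. Tao, Anal. PDE 6 (2013), Thm. 5.4
[cite: Tao2011, Thm. 5.4 (ii)+(iv)]; C. L. Fefferman, Clay problem description, (C)
[cite: FeffermanClay2006, (C)].
-/

noncomputable section

namespace Summit.NavierStokesRegularity.FluidComputer

open Set MeasureTheory Filter Topology Function
open scoped ENNReal ContDiff NNReal
open Literature.Analysis.FluidPDE
open Summit.NavierStokesRegularity.NavierStokesRegularity
open Summit.NavierStokesRegularity.FluidComputer.PalasekTowerClayBridge

namespace ClayBlowup

variable {ν : ℝ} (X : ClayBlowup ν)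

/-! ## §1 Serrin finiteness bounds the enstrophy, with NO pressure hypothesis -/

/-- The `H¹`-type slice bounds of the force of a Clay blow-up, on every slab. [cite: Tao2011, §1 p. 3] -/
theorem force_iteratedFDeriv_slices :
    ∀ n : ℕ, n ≤ 1 → ∃ C : ℝ≥0, ∀ t, 0 ≤ t → ∫⁻ x, ‖iteratedFDeriv ℝ n (X.f t) x‖ₑ ^ 2 ≤ C :=
  X.force_decay.exists_lintegral_iteratedFDeriv_slice_sq_le (μ := (volume : Measure _)) X.force_smooth

/-- **Serrin finiteness ⇒ uniform enstrophy bound on `[0, T)`, for ANY Clay blow-up** (`ν > 0`,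
`3 < r ≤ ∞`, time exponent `2/θ`, `θ = 1 − (3/r).toReal`): the proved forced Serrin–Grönwall
inequality `serrin_enstrophy_le_mul_exp_forced` on each closed sub-slab `[0, s]` with the Tao-class
pressure of `exists_taoPressure` there; the bound
`exp(κ ∫₀ᵀ ‖u‖_r^{2/θ}) (∫|∇u(0)|² + ν⁻¹ C₀ T)` does not depend on `s`. No named fact, no pressure or
`∂ₜu` hypothesis. [cite: LemarieRieusset2016, Thm. 11.2 (11.11)] [cite: Sohr2001, Thm. V.1.8.1] -/
theorem enstrophy_le_of_serrin (hν : 0 < ν) {r : ℝ≥0∞} (hr : 3 < r)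
    (hA : ∫⁻ t in Ioo 0 X.T,
      ENNReal.ofReal ((eLpNorm (X.u t) r volume).toReal ^ (2 / (1 - (3 / r).toReal))) ≠ ⊤) :
    ∃ B : ℝ≥0, ∀ s ∈ Ico 0 X.T, ∫⁻ x, ENNReal.ofReal (frobeniusNormSq (fderiv ℝ (X.u s) x)) ≤ B := by
  have hT := X.T_pos
  set θ : ℝ := 1 - (3 / r).toReal with hθ
  -- the force: slice bounds and the constant `L²` majorant
  obtain ⟨C₀, C₁, B, -, hC₀, -, -⟩ :=
    ForcedContinuation.exists_force_slice_bounds X.force_smooth X.force_decay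
  set F : ℝ → ℝ≥0∞ := fun _ => (C₀ : ℝ≥0∞) with hF
  have hFm : Measurable F := measurable_const
  have hFT : ∫⁻ t in Ioo 0 X.T, F t ≠ ⊤ := by
    rw [hF, setLIntegral_const, Real.volume_Ioo]
    exact ENNReal.mul_ne_top ENNReal.coe_ne_top ENNReal.ofReal_ne_top
  -- the constant of the inequality and its sign
  have h3r : (3 / r).toReal < 1 := by
    rcases eq_or_ne r ⊤ with hrtop | hrtop
    · rw [hrtop, ENNReal.div_top, ENNReal.toReal_zero]; exact zero_lt_one
    · have hρ3 : 3 < r.toReal := by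
        rw [← ENNReal.toReal_ofNat 3]; exact (ENNReal.toReal_lt_toReal (by norm_num) hrtop).2 hr
      rw [ENNReal.toReal_div, ENNReal.toReal_ofNat, div_lt_one (by linarith)]
      exact hρ3
  have hθ0 : 0 < θ := by rw [hθ]; linarith
  set K : ℝ≥0 := SNormLESNormFDerivOfEqConst (EuclideanSpace ℝ (Fin 3))
    (volume : Measure (EuclideanSpace ℝ (Fin 3))) 2 with hK
  set Cθ : ℝ := θ * (2 * (1 - θ)) ^ ((1 - θ) / θ) * 2 ^ (-(1 / θ)) * (K : ℝ) ^ (2 * (1 - θ) / θ)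
    with hCθ
  have hCθ0 : 0 ≤ Cθ := by
    have : 0 ≤ 1 - θ := by rw [hθ]; linarith [ENNReal.toReal_nonneg (a := 3 / r)]
    positivity
  have hκ0 : 0 ≤ 2 * Cθ * (ν / 2) ^ (1 - 2 / θ) := by positivity
  set AT : ℝ≥0∞ := ∫⁻ t in Ioo 0 X.T, ENNReal.ofReal ((eLpNorm (X.u t) r volume).toReal ^ (2 / θ))
    with hAT
  set Bound : ℝ≥0∞ := ENNReal.ofReal (Real.exp (2 * Cθ * (ν / 2) ^ (1 - 2 / θ) * AT.toReal)) *
    ((∫⁻ x, ENNReal.ofReal (frobeniusNormSq (fderiv ℝ (X.u 0) x))) +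
      (ENNReal.ofReal ν)⁻¹ * ∫⁻ t in Ioo 0 X.T, F t) with hBound
  -- the initial enstrophy is finite
  obtain ⟨D1, hD1⟩ := X.hasBoundedSobolevNormsOn hν (half_pos hT) (half_lt_self hT) 1
  have h0fin : ∫⁻ x, ENNReal.ofReal (frobeniusNormSq (fderiv ℝ (X.u 0) x)) < ⊤ :=
    (lintegral_frobeniusNormSq_le_three_mul_iteratedFDeriv_one (X.u 0)).trans_lt
      (ENNReal.mul_lt_top (by simp) ((hD1 0 ⟨le_rfl, (half_pos hT).le⟩).trans_lt ENNReal.coe_lt_top))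
  have hBtop : Bound ≠ ⊤ := by
    rw [hBound]
    refine ENNReal.mul_ne_top ENNReal.ofReal_ne_top (ENNReal.add_ne_top.2 ⟨h0fin.ne, ?_⟩)
    exact ENNReal.mul_ne_top (ENNReal.inv_ne_top.2 (by positivity)) hFT
  refine ⟨Bound.toNNReal, fun s hs => ?_⟩
  rw [ENNReal.coe_toNNReal hBtop]
  rcases eq_or_lt_of_le hs.1 with h0 | hs0
  · -- `s = 0`: the exponential factor is `≥ 1`
    rw [← h0, hBound]
    have hexp : (1 : ℝ≥0∞) ≤
        ENNReal.ofReal (Real.exp (2 * Cθ * (ν / 2) ^ (1 - 2 / θ) * AT.toReal)) := by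
      rw [← ENNReal.ofReal_one]
      exact ENNReal.ofReal_le_ofReal (Real.one_le_exp (mul_nonneg hκ0 ENNReal.toReal_nonneg))
    calc ∫⁻ x, ENNReal.ofReal (frobeniusNormSq (fderiv ℝ (X.u 0) x))
        ≤ 1 * ((∫⁻ x, ENNReal.ofReal (frobeniusNormSq (fderiv ℝ (X.u 0) x))) +
            (ENNReal.ofReal ν)⁻¹ * ∫⁻ t in Ioo 0 X.T, F t) := by rw [one_mul]; exact le_self_add
      _ ≤ _ := by gcongr
  · -- `0 < s < T`: the slab inequality on `[0, s]` with the Tao-class pressure there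
    obtain ⟨p', hsol, hut, hp⟩ := X.exists_taoPressure hν hs0 hs.2
    have hu : HasBoundedSobolevNormsOn (Icc 0 s) X.u := X.hasBoundedSobolevNormsOn hν hs0 hs.2
    have hf : ∀ n : ℕ, n ≤ 1 → ∃ C : ℝ≥0, ∀ t ∈ Icc 0 s,
        ∫⁻ x, ‖iteratedFDeriv ℝ n (X.f t) x‖ₑ ^ 2 ≤ C := fun n hn => by
      obtain ⟨C, hC⟩ := X.force_iteratedFDeriv_slices n hn
      exact ⟨C, fun t ht => hC t ht.1⟩
    have hsub : Ioo 0 s ⊆ Ioo 0 X.T := Ioo_subset_Ioo le_rfl hs.2.le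
    have hAs : ∫⁻ t in Ioo 0 s, ENNReal.ofReal ((eLpNorm (X.u t) r volume).toReal ^ (2 / θ)) ≤ AT :=
      lintegral_mono_set hsub
    have hFs : ∫⁻ t in Ioo 0 s, F t ≤ ∫⁻ t in Ioo 0 X.T, F t := lintegral_mono_set hsub
    have h := serrin_enstrophy_le_mul_exp_forced hν hs0 hsol hu hut hp hf F hFm
      (fun t _ => hC₀ t (hsub ‹_›).1.le) hr hθ ⟨hs0, le_rfl⟩ (ne_top_of_le_ne_top hA hAs)
      (ne_top_of_le_ne_top hFT hFs)
    refine h.trans ?_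
    rw [hBound]
    have hexp : Real.exp (2 * Cθ * (ν / 2) ^ (1 - 2 / θ) *
          (∫⁻ t in Ioo 0 s, ENNReal.ofReal ((eLpNorm (X.u t) r volume).toReal ^ (2 / θ))).toReal) ≤
        Real.exp (2 * Cθ * (ν / 2) ^ (1 - 2 / θ) * AT.toReal) :=
      Real.exp_le_exp.2 (mul_le_mul_of_nonneg_left (ENNReal.toReal_mono hA hAs) hκ0)
    gcongr

/-! ## §2 The Sohr corner, the Type-II floor, no sub-Leray rate — hypothesis-free -/

/-- **THE SOHR CORNER FOR EVERY CLAY BLOW-UP** (`ν > 0`; no named fact, NO pressure hypothesis): the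
velocity leaves every Ladyzhenskaya–Prodi–Serrin class at the lifespan,
`∫₀ᵀ ‖u(t)‖_{L^r}^{2/(1−3/r)} dt = ∞` for every `3 < r ≤ ∞` (time exponent `2/(1−(3/r).toReal)`,
`= 2` at `r = ∞`). [cite: Sohr2001, Thm. V.1.8.1] [cite: LemarieRieusset2016, Thm. 11.2] -/
theorem lintegral_serrin_eq_top (hν : 0 < ν) {r : ℝ≥0∞} (hr : 3 < r) :
    ∫⁻ t in Ioo 0 X.T,
        ENNReal.ofReal ((eLpNorm (X.u t) r volume).toReal ^ (2 / (1 - (3 / r).toReal))) = ⊤ := by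
  by_contra hA
  obtain ⟨B, hB⟩ := X.enstrophy_le_of_serrin hν hr hA
  exact X.not_exists_enstrophy_bound hν ⟨B, hB⟩

/-- **NO SUB-LERAY RATE IN ANY `L^r`** (`ν > 0`, `3 < r ≤ ∞`, `C ≥ 0`, `γ < (1 − (3/r).toReal)/2`;
no named fact, no pressure hypothesis): the bound `‖u(t)‖_{L^r} ≤ C (T−t)^{−γ}` on `(0, T)` is
impossible — its Serrin integral would converge. Leray's exponent `(1 − 3/r)/2` is the borderline.
[cite: Leray1934, (3.16)] [cite: LemarieRieusset2016, Thm. 11.4] -/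
theorem not_subLerayRate (hν : 0 < ν) {r : ℝ≥0∞} (hr : 3 < r) {C γ : ℝ} (hC : 0 ≤ C)
    (hγ : γ < (1 - (3 / r).toReal) / 2)
    (hrate : ∀ t ∈ Ioo 0 X.T, eLpNorm (X.u t) r volume ≤ ENNReal.ofReal (C * (X.T - t) ^ (-γ))) :
    False := by
  have htop := X.lintegral_serrin_eq_top hν hr
  set θ : ℝ := 1 - (3 / r).toReal with hθ
  have hθ0 : 0 < θ := DesignedBlowup.serrinExponent_pos hr
  set e : ℝ := 2 / θ with he
  have he0 : 0 ≤ e := by positivity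
  have hγe : γ * e < 1 := by
    rw [he, mul_div_assoc', div_lt_one hθ0]
    linarith
  have hfin := DesignedBlowup.lintegral_ofReal_rate_rpow_lt_top (γ := γ) X.T_pos hC hγe
  have hle : ∫⁻ t in Ioo 0 X.T, ENNReal.ofReal ((eLpNorm (X.u t) r volume).toReal ^ e) ≤
      ∫⁻ t in Ioo 0 X.T, ENNReal.ofReal ((C * (X.T - t) ^ (-γ)) ^ e) := by
    refine setLIntegral_mono' measurableSet_Ioo fun t ht => ENNReal.ofReal_le_ofReal ?_
    have hTt : 0 < X.T - t := by linarith [ht.2]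
    have hM0 : 0 ≤ C * (X.T - t) ^ (-γ) := mul_nonneg hC (Real.rpow_nonneg hTt.le _)
    have hN : (eLpNorm (X.u t) r volume).toReal ≤ C * (X.T - t) ^ (-γ) :=
      ENNReal.toReal_le_of_le_ofReal hM0 (hrate t ht)
    exact Real.rpow_le_rpow ENNReal.toReal_nonneg hN he0
  exact absurd (htop ▸ hle) (not_le.2 hfin)

/-- **THE TYPE-II FLOOR FOR EVERY CLAY BLOW-UP** (`ν > 0`; no named fact, no pressure hypothesis):
there are no `C ≥ 0` and `γ < 1/2` with `‖u(t)‖_{L^∞} ≤ C (T − t)^{−γ}` on `(0, T)` — the blow-up is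
at least Type I. [cite: Leray1934, (3.16)] [cite: LemarieRieusset2016, Thm. 11.2] -/
theorem not_subTypeI (hν : 0 < ν) {C γ : ℝ} (hCγ : 0 ≤ C) (hγ : γ < 1 / 2)
    (hrate : ∀ t ∈ Ioo 0 X.T, eLpNorm (X.u t) ⊤ volume ≤ ENNReal.ofReal (C * (X.T - t) ^ (-γ))) :
    False := by
  refine X.not_subLerayRate hν (r := ⊤) (by simp) hCγ ?_ hrate
  rw [ENNReal.div_top, ENNReal.toReal_zero, sub_zero]
  exact hγ

end ClayBlowup

/-! ## §3 The strong type and the Clay statement -/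

namespace DesignedBlowup

variable {ν : ℝ} (D : DesignedBlowup ν)

/-- **The Sohr corner for every designed forced blow-up, ANY pressure** (`ν > 0`; no named fact):
`∫₀ᵀ ‖u(t)‖_{L^r}^{2/(1−3/r)} dt = ∞` for every `3 < r ≤ ∞`. Supersedes the gauge-qualified rows
`lintegral_serrin_eq_top_{normalised,taoPressure}`. [cite: Sohr2001, Thm. V.1.8.1]
[cite: LemarieRieusset2016, Thm. 11.2] -/
theorem lintegral_serrin_eq_top_all (hν : 0 < ν) {r : ℝ≥0∞} (hr : 3 < r) :
    ∫⁻ t in Ioo 0 D.T,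
        ENNReal.ofReal ((eLpNorm (D.u t) r volume).toReal ^ (2 / (1 - (3 / r).toReal))) = ⊤ :=
  D.toClayBlowup.lintegral_serrin_eq_top hν hr

/-- **No sub-Leray rate for a designed forced blow-up, ANY pressure** (`ν > 0`; no named fact).
[cite: Leray1934, (3.16)] [cite: LemarieRieusset2016, Thm. 11.4] -/
theorem not_subLerayRate_all (hν : 0 < ν) {r : ℝ≥0∞} (hr : 3 < r) {C γ : ℝ} (hC : 0 ≤ C)
    (hγ : γ < (1 - (3 / r).toReal) / 2)
    (hrate : ∀ t ∈ Ioo 0 D.T, eLpNorm (D.u t) r volume ≤ ENNReal.ofReal (C * (D.T - t) ^ (-γ))) :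
    False :=
  D.toClayBlowup.not_subLerayRate hν hr hC hγ hrate

/-- **The Type-II floor for a designed forced blow-up, ANY pressure** (`ν > 0`; no named fact).
[cite: Leray1934, (3.16)] [cite: LemarieRieusset2016, Thm. 11.2] -/
theorem not_subTypeI_all (hν : 0 < ν) {C γ : ℝ} (hCγ : 0 ≤ C) (hγ : γ < 1 / 2)
    (hrate : ∀ t ∈ Ioo 0 D.T, eLpNorm (D.u t) ⊤ volume ≤ ENNReal.ofReal (C * (D.T - t) ^ (-γ))) :
    False :=
  D.toClayBlowup.not_subTypeI hν hCγ hγ hrate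

end DesignedBlowup

/-- **EVERY BREAKDOWN SCENARIO FOR (C) LEAVES EVERY SERRIN CLASS** (no named fact): if Fefferman's
(C) holds then at every `ν > 0` there is a Clay blow-up — a classical finite-energy forced evolution of
a Clay datum under a Clay force with finite lifespan `T` — with `∫₀ᵀ ‖u(t)‖_{L^r}^{2/(1−3/r)} dt = ∞`
for all `3 < r ≤ ∞` and no sub-Type-I rate. [cite: FeffermanClay2006, (C)] [cite: Sohr2001, Thm. V.1.8.1] -/
theorem breakdownR3_serrin
    (h : Summit.NavierStokesRegularity.NavierStokesRegularity.NavierStokesBreakdownR3)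
    {ν : ℝ} (hν : 0 < ν) :
    ∃ X : ClayBlowup ν,
      (∀ r : ℝ≥0∞, 3 < r → ∫⁻ t in Ioo 0 X.T,
        ENNReal.ofReal ((eLpNorm (X.u t) r volume).toReal ^ (2 / (1 - (3 / r).toReal))) = ⊤) ∧
      ∀ C γ : ℝ, 0 ≤ C → γ < 1 / 2 →
        ¬ ∀ t ∈ Ioo 0 X.T, eLpNorm (X.u t) ⊤ volume ≤ ENNReal.ofReal (C * (X.T - t) ^ (-γ)) := by
  obtain ⟨X⟩ := forall_nonempty_clayBlowup_of_breakdownR3 h ν hν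
  exact ⟨X, fun r hr => X.lintegral_serrin_eq_top hν hr,
    fun C γ hC hγ hrate => X.not_subTypeI hν hC hγ hrate⟩

end Summit.NavierStokesRegularity.FluidComputer

end
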